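import Mathlib
import Summits.Ventures.PercRepro2.RBDefs
import Summits.Ventures.PercRepro2.RBRoot
import Summits.Ventures.PercRepro2.RBRootDefs
import Summits.Ventures.PercRepro2.RBRootEdge
import Summits.Ventures.PercRepro2.RBRootEdgePin
import Summits.Ventures.PercRepro2.RBRootEdgeMain
import Summits.Ventures.PercRepro2.RBRootEdgeT
import Summits.Ventures.PercRepro2.RBRootIsolated
import Summits.Ventures.PercRepro2.RBTwoMarkers
import Summits.Ventures.PercRepro2.RBTwoMarkersCross
import Summits.Ventures.PercRepro2.BHKMixed
import Summits.Ventures.PercRepro2.RBMarkerEdge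
import Summits.Ventures.PercRepro2.RBMarkerEdgeMain

/-!
# The typed row 2′RB: every edge from the third vertex to `{s, t, b, o}` can be removed
(mine-a g6; MINE-A.md §39; proofs/MINEA-MARKEREDGE.md §1)

`RB.RBcross_and_RBsame_of_update_edge`: for an edge `g` from `w` to a root or a marker, both
forms of the row at `p` follow from both forms at `p[g ↦ 0]` (root edges: MINEA-ROOTEDGE,
`RBRootEdge.same_of_update` / `cross_of_update` / `_t`; marker edges: MINEA-MARKEREDGE,
`RBMarkerEdge.same_of_update_marker_b` / `cross_of_update_marker_b` / `_o`).
`RB.RBcross_and_RBsame_of_zero_marked`: the same for a finite set of such edges zeroed at once.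
`RB.RBcross_and_RBsame_of_unmarked`: **the row at `w` follows from the row at `w` in the graph in
which every edge between `w` and `{s, t, b, o}` has weight `0`** — the residual conjecture of the
row lives at third vertices without a marked neighbour.
-/

namespace Summit.Ventures.PercRepro2

namespace RB

open scoped Classical

variable {V : Type*} {E : Type*} [Fintype E] [DecidableEq E] [Fintype V] [DecidableEq V]
  {R : Type*} [Field R] [LinearOrder R] [IsStrictOrderedRing R]

omit [DecidableEq V] in
/-- **One edge from `w` to `{s, t, b, o}` can be removed (typed)**: both forms at `p` from both
forms at `p[g ↦ 0]`. -/
theorem RBcross_and_RBsame_of_update_edge {p : E → R} (hp : IsProbVec p) (ends : E → Sym2 V)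
    (o b s t w : V) {g : E}
    (hg : ends g = s(w, s) ∨ ends g = s(w, t) ∨ ends g = s(w, b) ∨ ends g = s(w, o))
    (h : RBcross (Function.update p g 0) ends o b s t w ∧
      RBsame (Function.update p g 0) ends o b s t w) :
    RBcross p ends o b s t w ∧ RBsame p ends o b s t w := by
  obtain ⟨hc, hs⟩ := h
  unfold RBcross Qst at hc
  unfold RBsame Qst at hs
  rw [rbSum_eq_rbRoot] at hc hs
  unfold RBcross RBsame Qst
  rw [rbSum_eq_rbRoot, rbSum_eq_rbRoot]
  rcases hg with hgs | hgt | hgb | hgo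
  · exact ⟨RBRootEdge.cross_of_update ends hp hgs hc, RBRootEdge.same_of_update ends hp hgs hs⟩
  · exact ⟨RBRootEdge.cross_of_update_t ends s t w hp hgt hc,
      RBRootEdge.same_of_update_t ends s t w hp hgt hs⟩
  · exact ⟨RBMarkerEdge.cross_of_update_marker_b ends hp hgb hc,
      RBMarkerEdge.same_of_update_marker_b ends hp hgb hs⟩
  · exact ⟨RBMarkerEdge.cross_of_update_marker_o ends hp hgo hc,
      RBMarkerEdge.same_of_update_marker_o ends hp hgo hs⟩

omit [DecidableEq V] in
/-- **A finite set of edges from `w` to `{s, t, b, o}` can be removed (typed)**: both forms at `p`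
from both forms at the weight vector with every edge of `F` zeroed. -/
theorem RBcross_and_RBsame_of_zero_marked {p : E → R} (hp : IsProbVec p) (ends : E → Sym2 V)
    (o b s t w : V) (F : Finset E)
    (hF : ∀ e ∈ F, ends e = s(w, s) ∨ ends e = s(w, t) ∨ ends e = s(w, b) ∨ ends e = s(w, o))
    (h : RBcross (fun e => if e ∈ F then 0 else p e) ends o b s t w ∧
      RBsame (fun e => if e ∈ F then 0 else p e) ends o b s t w) :
    RBcross p ends o b s t w ∧ RBsame p ends o b s t w := by
  induction F using Finset.induction_on with
  | empty =>
    simpa using h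
  | insert a F ha ih =>
    refine ih (fun e he => hF e (Finset.mem_insert_of_mem he)) ?_
    have hpF : IsProbVec (fun e => if e ∈ F then 0 else p e) :=
      ⟨fun e => by split_ifs; exacts [le_rfl, hp.nonneg e],
       fun e => by split_ifs; exacts [zero_le_one, hp.le_one e]⟩
    have heq : (fun e => if e ∈ insert a F then 0 else p e) =
        Function.update (fun e => if e ∈ F then 0 else p e) a 0 := by
      funext e
      by_cases h' : e = a
      · subst h'; simp
      · rw [Function.update_of_ne h']; simp [h']
    rw [heq] at h
    exact RBcross_and_RBsame_of_update_edge hpF ends o b s t w (hF a (Finset.mem_insert_self a F)) h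

/-- **Every edge from `w` to `{s, t, b, o}` can be removed (typed)**: both forms of the row at `p`
follow from both forms at the weight vector in which every edge between `w` and a root or a
marker has weight `0` — the row at a third vertex reduces to the row at a third vertex WITHOUT
marked neighbours. -/
theorem RBcross_and_RBsame_of_unmarked {p : E → R} (hp : IsProbVec p) (ends : E → Sym2 V)
    (o b s t w : V)
    (h : RBcross (fun e => if ends e = s(w, s) ∨ ends e = s(w, t) ∨ ends e = s(w, b) ∨
          ends e = s(w, o) then 0 else p e) ends o b s t w ∧
      RBsame (fun e => if ends e = s(w, s) ∨ ends e = s(w, t) ∨ ends e = s(w, b) ∨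
          ends e = s(w, o) then 0 else p e) ends o b s t w) :
    RBcross p ends o b s t w ∧ RBsame p ends o b s t w := by
  set F : Finset E := Finset.univ.filter
    (fun e => ends e = s(w, s) ∨ ends e = s(w, t) ∨ ends e = s(w, b) ∨ ends e = s(w, o)) with hF
  have hFmem : ∀ e ∈ F, ends e = s(w, s) ∨ ends e = s(w, t) ∨ ends e = s(w, b) ∨ ends e = s(w, o) :=
    fun e he => (Finset.mem_filter.1 he).2
  have heq : (fun e => if ends e = s(w, s) ∨ ends e = s(w, t) ∨ ends e = s(w, b) ∨
      ends e = s(w, o) then 0 else p e) = (fun e => if e ∈ F then 0 else p e) := by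
    funext e
    simp only [hF, Finset.mem_filter, Finset.mem_univ, true_and]
  rw [heq] at h
  exact RBcross_and_RBsame_of_zero_marked hp ends o b s t w F hFmem h

end RB

end Summit.Ventures.PercRepro2
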